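import Summits.Ventures.PercRepro.C041ZoneZSteps

/-!
# THEOREM Z — the ZONE LEMMA of C-041.md §12 is a theorem: `|𝓛_Z| ≤ |𝓡_Z|` (p6, gen 27)

Setting of `C041ZoneZSteps` (the abstract zone of `C041ZoneZDefs`; `A` the anchors, `Q` the protected anchors — `Q = ∅`
is the plain lemma, `Q = {c}` the `c`-variant of §12 (g)).  The FORCING FORM (§12 (b)): `Κ = 𝓛_Z ⊔ W` and
`Ρ′ = 𝓡_Z ⊔ W` with the common remainder `W = {adm ∧ ¬anchorDel ∧ blueK ∧ Γ}` (`Kset_eq_union`, `Pset_eq_union`;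
`W ⊆ Ρ′` because `REACH ⊆ K`), so `#𝓛_Z ≤ #𝓡_Z ↔ #Κ ≤ #Ρ′`.  The CHAIN `#Κ ≤ #K2 ≤ #P2 ≤ #Ρ′` by the three injections
`psi`, `chi`, `phi` of `C041ZoneZSteps` (`card_Kset_le_card_K2set`, `card_K2set_le_card_P2set`,
`card_P2set_le_card_Pset`).

* **`card_Lset_le_card_Rset`** — THEOREM Z: `#(Lset Q A) ≤ #(Rset Q A)` for every finite abstract zone (parallel edges,
  loops and multiplicities allowed), every anchor set and every protected anchor set, with and without the `c`-variant;
* `gam_empty` — with `Q = ∅` the constraint `Γ` is void, so `card_Lset_le_card_Rset Z ∅ A` is the plain ZONE LEMMA.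

NOT claimed here: the identification of `Lset` / `Rset` with the tree's `PercRepro.MultiGraph.Lset` / `Rset` of an indexed
zone (`C041ZoneSplitDefs`), i.e. `ZoneLemma a b c` itself — that dictionary is the next step.
-/

namespace PercRepro

namespace ZoneZ

namespace ZoneData

open Finset

variable {V E T₁ T₂ : Type*} (Z : ZoneData V E T₁ T₂) (Q A : Set V)

/-! ## Facts without finiteness -/

/-- `REACH ⊆ K`. -/
theorem REACH_subset_K (σ : State E T₁ T₂) : Z.REACH A σ ⊆ Z.K A σ := reachIn_subset_reach

/-- Blue at `K` forces «no red `2`-edge at `REACH`». -/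
theorem reach2_of_blueK {σ : State E T₁ T₂} (h : Z.blueK A σ) : Z.reach2 A σ :=
  Set.disjoint_of_subset (Z.REACH_subset_K A σ) Set.subset_union_right h

/-- With no protected anchor the constraint `Γ` is void. -/
theorem gam_empty (σ : State E T₁ T₂) : Z.Gam ∅ σ := by
  unfold Gam P
  rw [Set.disjoint_left]
  rintro v ⟨s, hs, _⟩
  exact absurd hs (Set.notMem_empty s)

variable [Fintype E] [DecidableEq E] [Fintype T₁] [DecidableEq T₁] [Fintype T₂] [DecidableEq T₂]

/-! ## Membership -/

/-- Membership in `𝓛_Z`. -/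
theorem mem_Lset {σ : State E T₁ T₂} :
    σ ∈ Z.Lset Q A ↔ Z.adm σ ∧ Z.blueK A σ ∧ Z.anchorDel A σ ∧ Z.Gam Q σ := by
  classical
  unfold Lset
  rw [Finset.mem_filter]
  exact and_iff_right (Finset.mem_univ _)

/-- Membership in `𝓡_Z`. -/
theorem mem_Rset {σ : State E T₁ T₂} :
    σ ∈ Z.Rset Q A ↔ Z.adm σ ∧ ¬ Z.anchorDel A σ ∧ Z.reach2 A σ ∧ ¬ Z.blueK A σ ∧ Z.Gam Q σ := by
  classical
  unfold Rset
  rw [Finset.mem_filter]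
  exact and_iff_right (Finset.mem_univ _)

/-- Membership in `Κ`. -/
theorem mem_Kset {σ : State E T₁ T₂} : σ ∈ Z.Kset Q A ↔ Z.adm σ ∧ Z.blueK A σ ∧ Z.Gam Q σ := by
  classical
  unfold Kset
  rw [Finset.mem_filter]
  exact and_iff_right (Finset.mem_univ _)

/-- Membership in `Ρ′`. -/
theorem mem_Pset {σ : State E T₁ T₂} :
    σ ∈ Z.Pset Q A ↔ Z.adm σ ∧ ¬ Z.anchorDel A σ ∧ Z.reach2 A σ ∧ Z.Gam Q σ := by
  classical
  unfold Pset
  rw [Finset.mem_filter]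
  exact and_iff_right (Finset.mem_univ _)

/-- Membership in `W`. -/
theorem mem_Wset {σ : State E T₁ T₂} :
    σ ∈ Z.Wset Q A ↔ Z.adm σ ∧ ¬ Z.anchorDel A σ ∧ Z.blueK A σ ∧ Z.Gam Q σ := by
  classical
  unfold Wset
  rw [Finset.mem_filter]
  exact and_iff_right (Finset.mem_univ _)

/-- Membership in `K2`. -/
theorem mem_K2set {σ : State E T₁ T₂} :
    σ ∈ Z.K2set Q A ↔ Disjoint (Z.M σ) (reachIn (Z.RedAdj σ) (Z.P Q σ)ᶜ (Z.Blt σ)) ∧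
      Disjoint (Z.Cmix Q A σ) (Z.Bl σ ∪ Z.Mt σ ∪ (Z.Blt σ ∩ Z.P Q σ)) ∧ Z.Gam Q σ := by
  classical
  unfold K2set
  rw [Finset.mem_filter]
  exact and_iff_right (Finset.mem_univ _)

/-- Membership in `P2`. -/
theorem mem_P2set {σ : State E T₁ T₂} :
    σ ∈ Z.P2set Q A ↔ Z.adm σ ∧ Disjoint (Z.Cmix Q A σ) (Z.Bl σ ∪ Z.Mt σ) ∧ Z.Gam Q σ := by
  classical
  unfold P2set
  rw [Finset.mem_filter]
  exact and_iff_right (Finset.mem_univ _)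

/-! ## The forcing form (L0) -/

/-- `Κ = 𝓛_Z ∪ W`. -/
theorem Kset_eq_union : Z.Kset Q A = Z.Lset Q A ∪ Z.Wset Q A := by
  ext σ
  rw [Finset.mem_union, Z.mem_Kset, Z.mem_Lset, Z.mem_Wset]
  constructor
  · rintro ⟨h1, h2, h3⟩
    by_cases h : Z.anchorDel A σ
    · exact Or.inl ⟨h1, h2, h, h3⟩
    · exact Or.inr ⟨h1, h, h2, h3⟩
  · rintro (⟨h1, h2, _, h3⟩ | ⟨h1, _, h2, h3⟩) <;> exact ⟨h1, h2, h3⟩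

/-- `Ρ′ = 𝓡_Z ∪ W`. -/
theorem Pset_eq_union : Z.Pset Q A = Z.Rset Q A ∪ Z.Wset Q A := by
  ext σ
  rw [Finset.mem_union, Z.mem_Pset, Z.mem_Rset, Z.mem_Wset]
  constructor
  · rintro ⟨h1, h2, h3, h4⟩
    by_cases h : Z.blueK A σ
    · exact Or.inr ⟨h1, h2, h, h4⟩
    · exact Or.inl ⟨h1, h2, h3, h, h4⟩
  · rintro (⟨h1, h2, h3, _, h4⟩ | ⟨h1, h2, h3, h4⟩)
    · exact ⟨h1, h2, h3, h4⟩
    · exact ⟨h1, h2, Z.reach2_of_blueK A h3, h4⟩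

/-- `𝓛_Z ∩ W = ∅`. -/
theorem disjoint_Lset_Wset : Disjoint (Z.Lset Q A) (Z.Wset Q A) := by
  rw [Finset.disjoint_left]
  intro σ h h'
  rw [Z.mem_Lset] at h
  rw [Z.mem_Wset] at h'
  exact h'.2.1 h.2.2.1

/-- `𝓡_Z ∩ W = ∅`. -/
theorem disjoint_Rset_Wset : Disjoint (Z.Rset Q A) (Z.Wset Q A) := by
  rw [Finset.disjoint_left]
  intro σ h h'
  rw [Z.mem_Rset] at h
  rw [Z.mem_Wset] at h'
  exact h.2.2.2.1 h'.2.2.1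

/-- `#Κ = #𝓛_Z + #W`. -/
theorem card_Kset_eq : #(Z.Kset Q A) = #(Z.Lset Q A) + #(Z.Wset Q A) := by
  rw [Z.Kset_eq_union Q A, Finset.card_union_of_disjoint (Z.disjoint_Lset_Wset Q A)]

/-- `#Ρ′ = #𝓡_Z + #W`. -/
theorem card_Pset_eq : #(Z.Pset Q A) = #(Z.Rset Q A) + #(Z.Wset Q A) := by
  rw [Z.Pset_eq_union Q A, Finset.card_union_of_disjoint (Z.disjoint_Rset_Wset Q A)]

/-! ## The chain `#Κ ≤ #K2 ≤ #P2 ≤ #Ρ′` -/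

/-- STEP 2 counted: `#Κ ≤ #K2` through the injection `psi`. -/
theorem card_Kset_le_card_K2set : #(Z.Kset Q A) ≤ #(Z.K2set Q A) := by
  refine Finset.card_le_card_of_injOn (Z.psi Q) ?_ fun σ _ σ' _ h => Z.psi_injective Q h
  intro σ hσ
  rw [Finset.mem_coe, Z.mem_Kset] at hσ
  rw [Finset.mem_coe, Z.mem_K2set]
  exact Z.psi_mem Q A σ hσ.1 hσ.2.1 hσ.2.2

/-- STEP 3 counted: `#K2 ≤ #P2` through the injection `chi`. -/
theorem card_K2set_le_card_P2set : #(Z.K2set Q A) ≤ #(Z.P2set Q A) := by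
  refine Finset.card_le_card_of_injOn (Z.chi Q A) ?_ fun σ _ σ' _ h => Z.chi_injective Q A h
  intro σ hσ
  rw [Finset.mem_coe, Z.mem_K2set] at hσ
  rw [Finset.mem_coe, Z.mem_P2set]
  exact Z.chi_mem Q A σ hσ.1 hσ.2.1 hσ.2.2

/-- STEP 1 counted: `#P2 ≤ #Ρ′` through the injection `phi`. -/
theorem card_P2set_le_card_Pset : #(Z.P2set Q A) ≤ #(Z.Pset Q A) := by
  refine Finset.card_le_card_of_injOn (Z.phi Q) ?_ fun σ _ σ' _ h => Z.phi_injective Q h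
  intro σ hσ
  rw [Finset.mem_coe, Z.mem_P2set] at hσ
  rw [Finset.mem_coe, Z.mem_Pset]
  exact Z.phi_mem Q A σ hσ.1 hσ.2.1 hσ.2.2

/-- The forcing form: `#Κ ≤ #Ρ′`. -/
theorem card_Kset_le_card_Pset : #(Z.Kset Q A) ≤ #(Z.Pset Q A) :=
  (Z.card_Kset_le_card_K2set Q A).trans ((Z.card_K2set_le_card_P2set Q A).trans (Z.card_P2set_le_card_Pset Q A))

/-! ## THEOREM Z -/

/-- **THEOREM Z** (C-041.md §12): `|𝓛_Z| ≤ |𝓡_Z|` for every finite abstract zone, every anchor set `A` and every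
protected anchor set `Q` (the plain ZONE LEMMA at `Q = ∅`, the `c`-variant at `Q = {c}`). -/
theorem card_Lset_le_card_Rset : #(Z.Lset Q A) ≤ #(Z.Rset Q A) := by
  have h := Z.card_Kset_le_card_Pset Q A
  rw [Z.card_Kset_eq Q A, Z.card_Pset_eq Q A] at h
  exact Nat.le_of_add_le_add_right h

end ZoneData

end ZoneZ

end PercRepro
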